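import Mathlib
import HarnessLib
import HarnessLib.Audit
import Summits.BirchSwinnertonDyer.Statement
import Summits.BirchSwinnertonDyer.Rank2.MatsunoAnalyticTwinAssembly
import Summits.BirchSwinnertonDyer.Rank2.MatsunoAnalyticTwinSymbolParity
import Summits.BirchSwinnertonDyer.Rank2.LambdaTransportDoorAtTwo
import Summits.BirchSwinnertonDyer.Rank2.LambdaTransportDoorAtTwoReferenceFacts
import Summits.BirchSwinnertonDyer.Rank2.LambdaTransportDoorAtTwoRootNumberFacts
import Summits.BirchSwinnertonDyer.Rank1Residual.X1.MuLambdaAlgebra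
import Literature.NumberTheory.EllipticCurves.LambdaInvariantCongruenceTransportAtTwo
import Literature.NumberTheory.EllipticCurves.GreenbergVatsal2000.NonPrimitivePAdicLFunction
import Literature.NumberTheory.EllipticCurves.PAdicLFunction
import Summits.BirchSwinnertonDyer.BirchSwinnertonDyer.Theorems.EisensteinDepletionAtTwoStarDefs
import Literature.NumberTheory.EllipticCurves.Gamma1ParametrizationCuspIdentityComponent
import Literature.NumberTheory.Automorphic.UnboundedDenominators
import HarnessLib.Audit.Status.Attr

/-!
Route: EisensteinDepletionAtTwo

CLOSED (closed) 2026-08-31T18:19:09Z by operator:999:2156901 — reason: success: CLOSED MODULO NAMED PRINTS — note: 21-frontier standing rule 2026-08-31T17:32Z + UDC scoped read CLEAN R1–R3 (pub/bsd-f1-sign2/UDC-SCOPED-READ-REPORT-g0.md e3e6e8ce1506e5be); every crux item proved in the kernel (std axioms); remaining inputs = named published theorems only: modularity (exists_isNewformOf = DS Thm 8.8.3) + CDT 2025 T. The file is kept as the record of this route; refuted decls are indexed as negative knowledge (`ledger negatives`).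

X = E1 ∧ E2, a genuine two-piece split of the analytic Matsuno twin X₁ (item
stmt-BirchSwinnertonDyer-20286, crux r4 on route
CountingDoorF2AtThree) in Greenberg–Vatsal's NON-PRIMITIVE currency. (E1) «depleted 2-adic λ-law»:
for a globally minimal E = W/ℚ, good
ordinary at 2, with exactly ONE rational point of order 2, of Greenberg type A or B, any newform f
of W, any nonzero integral rational multiple
L₀ of L₂(f, α) and any finite set S of primes containing the primes of N_W, the SCALE-FREE
λ-invariant of the S-depleted element obeys
lam(L₀ · ∏_{ℓ ∈ S, ℓ ≠ 2} 𝒫_ℓ(T)) + 2 = Σ_{ℓ ∈ S, ℓ ≠ 2} 2^{n_ℓ + 1}, n_ℓ = ord₂((ℓ² − 1)/8), 𝒫_ℓ =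
the tree's Euler-factor element
`GreenbergVatsal2000.eulerFactorElement W 2 v_ℓ` — the right side is the λ of the S-depleted 2-adic
EISENSTEIN side (2^{n_ℓ+1} per Euler
factor, −2 for the two poles), i.e. Greenberg–Vatsal Thm 3.11 transposed to p = 2 with the character
L-functions folded into an explicit
count. (E2) «depletion shift at 2»: lam(L₀ · ∏𝒫_ℓ) = lam L₀ + Σ_S(W) (Σ_S = Matsuno's
`matsunoSigmaShiftAtTwo`, s_ℓ·d̄_ℓ) — GV display (9) /
Prop 2.4 at p = 2 — IN SUBSTANCE A TREE THEOREM
(`Theorems.TwoAdicTwistConverse.lam_mul_eulerFactorProduct_two` +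
`order_map_toZMod_eulerFactorElement_two`, file Theorems/TwoAdicConverseEulerFactorAtTwo.lean, with
lit's landed dictionary `dMultiplicity_two_eq_matsunoLocalTermAtTwo`, p519918; director-bsd
09:23:59Z): support-grade, kept as an item only until eng-2 g5's proof lands — the route's ONE open
crux is E1. KERNEL JOIN (folder SketchB.lean, rc 0):
E1 → E2 → X₁ (`analyticTwin_of_pieces`, X₁ verbatim =
`Rank2.MatsunoAnalyticTwin.AnalyticMatsunoTwinAtTwo`), and then eng-2's landed
`Rank2.MatsunoAnalyticTwin.leaf_of_cruxes` (p515447: X₁ → LevelFifteenSymbolParity →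
SigmaShiftIdentityRef → PublishedInputsAtTwoM →
RootNumberFacts → ReferenceFacts → leaf) gives corank Sel_2^∞ = ord_T L₂ = 3 on the odd-sign members
of the 8-15-17 family.
Lean: `Summit.BirchSwinnertonDyer.Rank2.Family81517.SelmerCorankEqOrderEqThreeOnOddFamily`

CLOSES_TARGET: closes rung S0 door T-r3₂ of BirchSwinnertonDyer: Summit.BirchSwinnertonDyer.Rank2.Family81517.SelmerCorankEqOrderEqThreeOnOddFamily (D-0061; not the summit Statement) — the deciding theorem of this route concludes that registered leaf instead of the Statement decl `BirchSwinnertonDyer` (class rung: servable and labelled, never counted as concluding the summit Statement).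

Rationale: WHY THIS LINE. X₁ (analytic Matsuno twin, item 20286) alone is one XL crux; Greenberg–Vatsal's own
proof shape supplies its genuine split: every printed analytic λ-statement for a residually
REDUCIBLE curve (GreenbergVatsal2000 §3, Thm 3.11/(26)–(28), p odd) is about the NON-PRIMITIVE
function L_{Σ₀} = L·∏𝒫_ℓ, congruent to a product of S-depleted Kubota–Leopoldt functions whose λ is
an explicit count, and the passage back to L is display (9). At p = 2 the Eisenstein side cannot be
typed as a character L-function in Λ (the 2-adic ζ has a pole; lit GEN 17 TRAP note), so E1 states
its λ-count directly: Σ_{ℓ∈S,ℓ≠2} 2^{n_ℓ+1} − 2 (for full rational 2-torsion this is Matsuno2008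
Prop 6.2's Σ ord_ℓ(N)·2^{n_ℓ} − 2, ALGEBRAIC side, in print). Imported from analytic Iwasawa theory
at odd p: Vatsal1999 / GreenbergVatsal2000 (canonical periods, multiplicity one (18)),
EmertonPollackWeston2006, BellaichePollack2019 / PollackWake2025; at p = 2 only Matsuno2000JNT Thm
3.1 (Kida along real quadratic twists) is printed. New here: p = 2, ρ̄ reducible, typed scale-free
(lam of any nonzero rational multiple — μ and periods never enter), with Greenberg's type-A/B
condition as the p = 2 «admissible sign». STATE (rev 22, p2 GEN 52, 2026-08-30): E2
`DepletionShiftAtTwo` is PROVED (p526655); LevelFifteenSymbolParity / SigmaShiftIdentityRef /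
ReferenceFacts are theorems by name; the load-bearing research crux E1M_NSF
`DepletedLambdaLawAtTwoModNSF` (27021: E1M restricted to NON-SQUAREFREE conductors — all the leaf
needs, N_E = 3·5·m·q²·r) and both its Σ-split children StarGO2Sigma (27046) / StarOptBNSF (27047)
are PROVED MODULO TWO PRINTS by landed theorems — p748463
`Theorems.DepletionAtTwo.StarTwoPrints.depletedLambdaLawAtTwoModNSF_of_twoPrints : (F) → UBD →
E1M_NSF`, p748742 `starGO2Sigma_of_modularity_twoPrints`, p728662
`SigmaNode.starOptBNSF_of_twoPrints` — after the lead's four audits of line `star` (v19–v23; print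
floor exactly {(F), UBD}; Abbes–Ullmo, Stevens-at-2 and generalized-Ogg-at-2 all eliminated as
inputs). (F) =
`Literature.NumberTheory.EllipticCurves.ModularForms.gamma1Parametrization_cuspImage_nonsingularReduction`
(cusp images under an X_μ(N)-parametrisation reduce into the identity component:
Conrad–Edixhoven–Stein 2003 §6.1.2 + Katz–Mazur 12.6.1 (Igusa) + Silverman ATAEC IV.9.1), UBD =
`Literature.NumberTheory.Automorphic.CalegariDimitrovTang2025_unboundedDenominators`
(Calegari–Dimitrov–Tang 2025 Thm 1); both are statement-only Literature facts. Since those Theorems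
modules import this file, `closes` (rev 22) binds each print BY NAME — StarPrintF := (F),
StarPrintUBD := UBD — and consumes E1M_NSF through the support DepletedLambdaLawAtTwoModNSFOfPrints
:= StarPrints → E1M_NSF (StarPrints := (F) ∧ UBD, fed with ⟨hF, hU⟩; closed by a one-line re-export
of p748463), and is otherwise the rev-17 member-wise proof (E1M_NSF at (E, x = 0, type B) with S =
primeFactors(15·N_E) plus E2 ⇒ lam L₀ + 4 + 2 = 10 ⇒ λ = 4 ⇒ `LambdaTransportDoor.closes'`). The
research items 27021/27046/27047 are ASIDE (banked with their evidence, censuses and registered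
lines star / nsf / parities / cfsplit); the route's OPEN binders are PRINTS ONLY. B1: the leaf is
the rung-S0 door T-r3₂ (corank = ord_T L₂ = 3 on the odd-sign 8-15-17 members), not BSD for any
curve.

RANKED CRUXES. No open research crux remains. In the cone of `closes`: #9 StarPrintF and
StarPrintUBD (supports, PRINT binders, one named fact each, rev 22; each closes when its fact gets a
`_holds` theorem — (F) needs X_μ(N)/Néron models over ℤ, UBD is CDT 2025 itself; why (F) might fail
AS TYPED: a 2πi/orientation mismatch between the tree's cuspSymbol / periodLatticeGamma1 /
IsNeronLatticeOf conventions and CES Lemma 6.1.6 would make the Prop differ from print)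
[ConradEdixhovenStein2003, KatzMazur1985, SilvermanATAEC1994, CalegariDimitrovTang2025]; StarPrints
(rev 21, the conjunction (F) ∧ UBD) is ASIDE — superseded by the two single-fact items so that the
print tracker sees each fact, kept as the antecedent of the next item; #9
DepletedLambdaLawAtTwoModNSFOfPrints (support, PROVABLE NOW by `fun hP =>
StarTwoPrints.depletedLambdaLawAtTwoModNSF_of_twoPrints hP.1 hP.2`, file text
HOME/p2/g52/OfPrintsHolds.lean, kernel-checked in the tenure Sketch); #3 DepletionShiftAtTwo —
CLOSED PROVED (p526655); #9 PublishedInputsAtTwoM (20247), RootNumberProductFormulaF (20274) — print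
binders (typer-grade); ReferenceFacts — by name, closed. ASIDE (banked, proved modulo print): #2
DepletedLambdaLawAtTwoModNSF (27021) [p748463], #201 StarGO2Sigma (27046) [p748742, + modularity],
#202 StarOptBNSF (27047) [p728662]; glue #203 DepletedLambdaLawAtTwoModNSFOfStar (27048) closed;
older asides E1M (20341) / StarGO2 (24444) / StarOptB (24445) / E1 (20237) / RootNumberFacts (20248)
unchanged. NUMERICS OF RECORD unchanged (type B 42/42, type A 48/48, COROLLARY NSF 1541/1541,
THEOREM B(i) all MATCH, F1/F1′ 0 violations, eng cert5 6509 classes 0 failures).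

TWO-LAYER PLAN. None active: layer 2 (the Σ-split of E1M_NSF) is proved modulo print; no further
split, no third layer; the registered lines stay attached to the asides as the record of how the
print floor was reached.

KILL CRITERIA. The kernel content is closed; what can still die is a PRINT BINDER AS TYPED. (F) is
refuted-misstated if a grounder shows the typed Prop differs from CES 2003 Lemma 6.1.6 + Igusa +
ATAEC IV.9.1 (repair: re-type (F) in Literature, re-export p748463 against it — the four audits pin
exactly which instance line star uses: E = the 2-isogenous partner E₀/P, π(γ∞) = generator of the
dual kernel); UBD as typed is CDT Thm 1 verbatim (bounded at cusps, integer coefficients in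
q^{1/h}). A certified λ-scan counterexample to E1M_NSF (engines HOME/p2/g15/e0scan_v6.gp,
HOME/p2/g17/typeA_scan.gp; one good-ordinary-at-2 NON-SQUAREFREE class of type A/B with λ₂,an ≠
LAW(N) − 2 at two agreeing levels) would now CONTRADICT p748463 and therefore locate a mis-typing of
(F)/UBD or of a tree definition — publishable either way; close --reason refuted:<binder> only if
the repaired typing no longer yields E1M_NSF on the family. The leaf itself dies only with a member
of 𝓕₋ having ord_T L₂ ≥ 5.

NOT DECOMPOSED YET. Nothing: the route is COMPLETE MODULO PRINT {(F), UBD, PublishedInputsAtTwoM,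
RootNumberProductFormulaF} and should be read as such on the funnel (rung S0 door, class rung —
never distance-to-summit). The prints are typer / literature-prover work, not planner cruxes: WANTED
(cell bus, standing) `_holds` for (F) [ConradEdixhovenStein2003 §6.1.2 p. 381; KatzMazur1985 Thm
12.6.1; SilvermanATAEC1994 IV.9.1] and for UBD [CalegariDimitrovTang2025 Thm 1]; no definition
request.

CHEAPEST FALSIFIER. RUN (unchanged): kit j270999/j271233/j271742/j272856 (type B 42/42, N ≤ 425),
j277420 (type A 48/48, N ≤ 1000), j277565 ((A′) 21/21), p2 GEN 29 F1/F1′ (j300932/j300946/j301225, 0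
violations N ≤ 1501), T2 COROLLARY NSF 1541/1541, S1 THEOREM B(i) all MATCH, star-p1 GEN 5
prime-power edge, eng-2 GEN 14 cert5 (6509 classes, 0 failures). NEXT CHEAPEST (and the only one
that still bites): a grounder's normalisation audit of (F) — one `example` per convention
(cuspSymbol = 2πi∫_{i∞}^{γ∞} f dτ vs CES; periodLatticeGamma1 = Λ₁(f); IsNeronLatticeOf orientation)
against the instance line star uses (file Theorems/EisensteinDepletionAtTwoStarE1MTwoPrints.lean
docstrings).

Novelty: Searches (G13–G16 + lit GEN 17 dossier): lit search --hybrid "Greenberg Vatsal non-primitive p-adic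
L-function Eisenstein congruence p = 2" / "Mazur-Tate elements congruences lambda invariant p = 2" /
"Iwasawa invariants 2-adic L-function elliptic curve rational 2-torsion"; lit vsearch "analytic
lambda invariant of the 2-adic L-function of an elliptic curve with a rational 2-torsion point
equals a sum of local terms"; lit galaxy search "lambda-invariant|Mazur-Tate|2-adic L-function"
--star all, "Eisenstein ideal|multiplicity one" --star pdf; lean search eulerFactorElement /
matsunoSigmaShiftAtTwo / order_map_toZMod_eulerFactorElement / plusSymbol_congruence.
Nearest prior art found: GreenbergVatsal2000 Thm 3.11/(9)/Prop 2.4 [corpus:arxiv-math_9906215 p.8–9,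
p.22, p.43] («p a fixed ODD prime», multiplicity one (18) p.33); Vatsal1999 Thm 1.10/1.13;
Matsuno2008 Prop 6.2 / Thm 4.2 [corpus:matsuno2008 p.413, p.418] (ALGEBRAIC λ at 2, full or
same-field 2-torsion); Matsuno2000JNT Thm 3.1 [corpus:paper:doi-10-1006-jnth-2000-2510 p.7]
(analytic Kida formula at 2 along real quadratic twists, μ = 0); BellaichePollack2019 /
PollackWake2025 (Eisenstein families, p ≥ 5, prime level) [galaxy:pdf:-4456907251306002080 p.1];
Pollack–Weston Mazur–Tate («Fix an odd prime p») [galaxy:pdf:-6535538855114364040 p.1];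
EmertonPollackWeston2006 (p odd); tree:
`X2.EulerFactorInvariants.order_map_toZMod_mul_eulerFactorProduct` (E2 at p ≠ 2),
`greenbergVatsal2000_plusSymbol_congruence` (p ≠ 2, irreducibl  [refs: arxiv-math_9906215, paper:doi-10-1006-jnth-2000-2510, GreenbergVatsal2000, Vatsal1999, Matsuno2008, BellaichePollack2019, PollackWake2025, EmertonPollackWeston2006]

Barriers (technique_class: eisenstein-congruence-2, mazur-tate, depletion): - technique_class: eisenstein-congruence-2, mazur-tate, depletion
- Literature.Barriers.BirchSwinnertonDyer.EisensteinMuBarrier: outside — the barrier (Greenberg Prop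
5.7: a RAMIFIED AND ODD rational line forces μ ≥ 1, no unit content) is stated for p ≠ 2, and at 2
its locus «ramified ∧ odd» is exactly what the type-A (ramified, NOT odd) / type-B (odd, NOT
ramified) hypothesis of E1 excludes; moreover E1/E2 are scale-free (lam of pfree), so a positive μ
cannot bite.
- Literature.Barriers.BirchSwinnertonDyer.SignedIwasawaTheoryAtTwoBarrier: outside — supersingular
at 2 (a₂ even); E1 is good ORDINARY at 2.
- Literature.Barriers.BirchSwinnertonDyer.AdditiveIwasawaTheoryAtTwoBarrier: outside — additive at
2; E1 is good ordinary at 2.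
- Literature.Barriers.BirchSwinnertonDyer.NumericalVanishingBarrier: outside — nothing decides the
vanishing of a real number; λ is read off a unit coefficient mod 2 of an integral power series (a
NON-vanishing certificate at finite level), and the leaf is corank = ord_T (algebraic =
2-adic-analytic), not r_an.
- Literature.Barriers.BirchSwinnertonDyer.DokchitserDokchitser2011_rankMod_notSumOfLocalInvariants:
outside — the barrier (Dokchitser–Dokchitser 2011, RankNotSumOfLocalInvariants) forbids the
Mordell–Weil RANK (mod n) being a local sum over all curves/number fields; E1 computes the Iwasawa λ
of L₂ (an upper bound for the corank, not the rank: 15A8 λ = 0 = rank, members λ = 4 > 3) on a thin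
class over ℚ, the printed algebraic analogue being Mat

History (route lifecycle, newest last):
- 2026-08-27T10:43:03Z · rev 4: restated DepletedLambdaLawAtTwoMod (stmt-BirchSwinnertonDyer-20340) — staffability: inline the modularity body (the named fact exists_isNewformOf is cite_only and made the cone unstaffable); meaning unchanged (planner-bsd-rank2-p2-g16-0)
- 2026-08-31T18:19:10Z · CLOSED closed — success: CLOSED MODULO NAMED PRINTS (operator:999:2156901)

sub-problem: BirchSwinnertonDyer · status: closed(closed) · opened planner-bsd-rank2-p2-g16-0 2026-08-27T09:49:12Z · rev 24 · ledger route-BirchSwinnertonDyer-EisensteinDepletionAtTwo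
GENERATED by the gate from the ledger (D-0016/17). Provers cite these decls: `theorem foo : Summit.BirchSwinnertonDyer.BirchSwinnertonDyer.Theses.EisensteinDepletionAtTwo.<Decl> := …` in Summits/BirchSwinnertonDyer/BirchSwinnertonDyer/Theorems/<Name>.lean.
-/

namespace Summit.BirchSwinnertonDyer.BirchSwinnertonDyer.Theses.EisensteinDepletionAtTwo

open scoped BigOperators Topology Manifold Classical MeasureTheory ProbabilityTheory Matrix InnerProductSpace ComplexConjugate ContinuousMap
open Filter Set Function TopologicalSpace MeasureTheory

attribute [summit_statement] _root_.BirchSwinnertonDyer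
attribute [summit_statement] _root_.Summit.BirchSwinnertonDyer.Rank2.Family81517.SelmerCorankEqOrderEqThreeOnOddFamily

open Literature

/-! Retired items kept as plain definitions (history; not obligations of this route): landed proofs / closed glue still name them. -/

/-- retired stmt-BirchSwinnertonDyer-27046 (moot, gen 1) — named by an active item. -/
def StarGO2Sigma : Prop :=
  ∀ (W : WeierstrassCurve ℚ) [W.IsElliptic] [W.IsGloballyMinimal] (W₀ : WeierstrassCurve ℚ) [W₀.IsElliptic] [W₀.IsGloballyMinimal] ⦃N : ℕ⦄ [NeZero N] (f : CuspForm (CongruenceSubgroup.Gamma0 N) 2), Literature.NumberTheory.EllipticCurves.ModularForms.IsNewformOf W f → Literature.NumberTheory.EllipticCurves.ModularForms.IsNewformOf W₀ f → Literature.NumberTheory.EllipticCurves.IsOrdinaryAt W 2 → ∀ (L₀ : PeriodPair), Literature.NumberTheory.EllipticCurves.ModularForms.IsNeronLatticeOf (W₀.baseChange ℂ) L₀ → ∀ (q : ℚ), q ≠ 0 → (∀ z ∈ Literature.NumberTheory.EllipticCurves.ModularForms.periodLattice f, (q : ℂ) * z ∈ L₀.lattice) → (∀ z ∈ L₀.lattice,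 ∃ w ∈ Literature.NumberTheory.EllipticCurves.ModularForms.periodLattice f, z = (q : ℂ) * w) → ∀ (x₀ : ℚ), Literature.NumberTheory.EllipticCurves.Greenberg1999.HasRationalTwoTorsionX W₀ x₀ → ¬ Literature.NumberTheory.EllipticCurves.Greenberg1999.TwoTorsionRamifiedAtTwo x₀ → ∀ (lam : ℂ), lam ∈ L₀.lattice → lam / 2 ∉ L₀.lattice → L₀.weierstrassP (lam / 2) - ((W₀.b₂ : ℚ) : ℂ) / 12 = ((x₀ : ℚ) : ℂ) → (∃ β : ℕ → ℕ, Summit.BirchSwinnertonDyer.BirchSwinnertonDyer.Theorems.DepletionAtTwo.IsAdmissibleStabData (W.conductorNorm ℤ) β) → ∃ β : ℕ → ℕ, Summit.BirchSwinnertonDyer.BirchSwinnertonDyer.Theorems.DepletionAtTwo.IsAdmissibleStabData (W.conductorNorm ℤ) β ∧ ∃ g' : ℚ, g' ≠ 0 ∧ ∃ e : ℤ → ℤ, (∀ b d : ℤ, 0 < d → Int.gcd d (b * (W.conductorNorm ℤ : ℕ)) = 1 → ∃ n' : ℤ, Summit.BirchSwinnertonDyer.BirchSwinnertonDyer.Theorems.DepletionAtTwo.stabEisensteinPeriod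 (W.conductorNorm ℤ) β (Int.gcdA d (b * (W.conductorNorm ℤ : ℕ))) b (-((W.conductorNorm ℤ : ℕ) : ℤ) * Int.gcdB d (b * (W.conductorNorm ℤ : ℕ))) d = n' * g' ∧ (Even n' ↔ ((∃ k : ℤ, ∃ w ∈ L₀.lattice, (q : ℂ) * (Literature.NumberTheory.EllipticCurves.ModularForms.modularSymbol f ((b : ℚ) / (d : ℚ)) - Literature.NumberTheory.EllipticCurves.ModularForms.modularSymbol f 0) = (k : ℂ) * lam + 2 * w) ↔ Even (e d)))) ∧ (∃ b d : ℤ, 0 < d ∧ Int.gcd d (b * (W.conductorNorm ℤ : ℕ)) = 1 ∧ ∃ n' : ℤ, Summit.BirchSwinnertonDyer.BirchSwinnertonDyer.Theorems.DepletionAtTwo.stabEisensteinPeriod (W.conductorNorm ℤ) β (Int.gcdA d (b * (W.conductorNorm ℤ : ℕ))) b (-((W.conductorNorm ℤ : ℕ) : ℤ) * Int.gcdB d (b * (W.conductorNorm ℤ : ℕ))) d = n' * g' ∧ Odd n')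

/-- retired stmt-BirchSwinnertonDyer-27047 (moot, gen 1) — named by an active item. -/
def StarOptBNSF : Prop :=
  ∀ (W : WeierstrassCurve ℚ) [W.IsElliptic] [W.IsGloballyMinimal] (x : ℚ), Literature.NumberTheory.EllipticCurves.IsOrdinaryAt W 2 → Literature.NumberTheory.EllipticCurves.HasUniqueRationalTwoTorsionX W x → ((Literature.NumberTheory.EllipticCurves.Greenberg1999.TwoTorsionRamifiedAtTwo x ∧ ¬ Literature.NumberTheory.EllipticCurves.Greenberg1999.TwoTorsionOdd W x) ∨ (Literature.NumberTheory.EllipticCurves.Greenberg1999.TwoTorsionOdd W x ∧ ¬ Literature.NumberTheory.EllipticCurves.Greenberg1999.TwoTorsionRamifiedAtTwo x)) → W.conductorNorm ℤ ≠ 15 → ¬ Squarefree (W.conductorNorm ℤ) → ∀ ⦃N : ℕ⦄ [NeZero N] (f : CuspForm (CongruenceSubgroup.Gamma0 N) 2), Literature.NumberTheory.EllipticCurves.ModularForms.IsNewformOf W f → ∀ (W₀ : WeierstrassCurve ℚ) [W₀.IsElliptic] [W₀.IsGloballyMinimal], Literature.NumberTheory.EllipticCurves.ModularForms.IsNewformOf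 W₀ f → ∀ (L₀ : PeriodPair), Literature.NumberTheory.EllipticCurves.ModularForms.IsNeronLatticeOf (W₀.baseChange ℂ) L₀ → ∀ (q : ℚ), q ≠ 0 → (∀ z ∈ Literature.NumberTheory.EllipticCurves.ModularForms.periodLattice f, (q : ℂ) * z ∈ L₀.lattice) → (∀ z ∈ L₀.lattice, ∃ w ∈ Literature.NumberTheory.EllipticCurves.ModularForms.periodLattice f, z = (q : ℂ) * w) → ∃ x₀ : ℚ, Literature.NumberTheory.EllipticCurves.Greenberg1999.HasRationalTwoTorsionX W₀ x₀ ∧ Literature.NumberTheory.EllipticCurves.Greenberg1999.TwoTorsionOdd W₀ x₀ ∧ ¬ Literature.NumberTheory.EllipticCurves.Greenberg1999.TwoTorsionRamifiedAtTwo x₀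

/-- item stmt-BirchSwinnertonDyer-27021 · crux · rank 2 · closed · proved by Summit.BirchSwinnertonDyer.BirchSwinnertonDyer.Theorems.EisensteinDepletionAtTwo.DepletedLambdaLawAtTwoModNSF_proof (prover) · by planner
why it might fail: THEOREMS A/B are unrefereed cell memos (UBD⇒Shimura needs an everywhere-unramified μ₂-cover incl. the étale step at p = 2 and ±I/elliptic bookkeeping); a non-squarefree odd N with c_β ∈ Σ_N for every admissible β, or non-Gorenstein Eisenstein ideal above 2 at an additive prime, breaks the chain.
sources: GreenbergVatsal2000, Matsuno2008, Vatsal2005, CalegariDimitrovTang2025, LingOesterle1991, Stevens1982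
retired/moot children: StarGO2Sigma [moot: ∀ (W : WeierstrassCurve ℚ) [W.IsElliptic] [W.IsGloballyMinimal] (W₀ : Weierstras]; StarOptBNSF [moot: ∀ (W : WeierstrassCurve ℚ) [W.IsElliptic] [W.IsGloballyMinimal] (x : ℚ), Literat]
[crux] E1M_NSF = E1M RESTRICTED TO NON-SQUAREFREE CONDUCTORS: modularity (the clause of
PublishedInputsAtTwoM) → for W globally minimal, good ordinary at 2, with a unique rational
2-torsion point of Greenberg type A xor B, ¬Squarefree N_W, any newform f of W, any c ∈ ℚ and L₀ ≠ 0
in Λ with ι L₀ = c·L₂(f, α_W), any finite prime set S ⊇ primes of N_W: lam(L₀·∏_{ℓ∈S, ℓ≠2} 𝒫_ℓ(W)) +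
2 = Σ_{ℓ∈S, ℓ≠2} 2^{n_ℓ+1}. RE-TARGET (tenure p2 GEN 30): the leaf's family has N_E = 3·5·m·q²·r
(tree `Family81517.two_le_factorization_conductorNorm_curve_q`), so the deciding theorem needs the
depleted λ-law ONLY at non-squarefree level and closes MEMBER-WISE (E1M_NSF + E2 at E with S =
primeFactors(15·N_E) = {3,5,m,q,r}: lam L₀ + σ(E,S) + 2 = 10, σ(E,S) = 4 ⇒ lam L₀ = 4 = λ(X) ⇒ door
closes'; no reference curve, no X₁, no Assembly item). The squarefree composite case (Stevens'
conjecture at 2 = StarOptB at squarefree N ≠ 15, generalized Ogg at 2 at squarefree N) LEAVES the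
critical path; E1M (stmt-20341), StarGO2, StarOptB, E1, RootNumberFacts become banked asides. PAPER
CHAIN (cell memos HOME/p2/g29): E1M_NSF ⇐ StarGO2Sigma ∧ StarOptBNSF (kernel: pointwise port of
p611861 `depletedLambdaLawAtTwoMod_of_ -/
@[route_item "route-BirchSwinnertonDyer-EisensteinDepletionAtTwo"]
def DepletedLambdaLawAtTwoModNSF : Prop :=
  (∀ (V : WeierstrassCurve ℚ) [V.IsElliptic] [NeZero (V.conductorNorm ℤ)], ∃ g : CuspForm (CongruenceSubgroup.Gamma0 (V.conductorNorm ℤ)) 2, Literature.NumberTheory.EllipticCurves.ModularForms.IsNewformOf V g) → ∀ (W : WeierstrassCurve ℚ) [W.IsElliptic] [W.IsGloballyMinimal] (x : ℚ), Literature.NumberTheory.EllipticCurves.IsOrdinaryAt W 2 → Literature.NumberTheory.EllipticCurves.HasUniqueRationalTwoTorsionX W x → ((Literature.NumberTheory.EllipticCurves.Greenberg1999.TwoTorsionRamifiedAtTwo x ∧ ¬ Literature.NumberTheory.EllipticCurves.Greenberg1999.TwoTorsionOdd W x) ∨ (Literature.NumberTheory.EllipticCurves.Greenberg1999.TwoTorsionOdd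 W x ∧ ¬ Literature.NumberTheory.EllipticCurves.Greenberg1999.TwoTorsionRamifiedAtTwo x)) → ¬ Squarefree (W.conductorNorm ℤ) → ∀ ⦃N : ℕ⦄ [NeZero N] (f : CuspForm (CongruenceSubgroup.Gamma0 N) 2), Literature.NumberTheory.EllipticCurves.ModularForms.IsNewformOf W f → ∀ (c : ℚ) (L₀ : Literature.NumberTheory.EllipticCurves.IwasawaAlgebra 2), L₀ ≠ 0 → Literature.NumberTheory.EllipticCurves.iwasawaToPowerSeries 2 L₀ = PowerSeries.C (c : ℚ_[2]) * Literature.NumberTheory.EllipticCurves.padicLFunction f (Literature.NumberTheory.EllipticCurves.unitRoot W 2 : ℚ_[2]) → ∀ (S : Finset ℕ), (∀ ℓ ∈ S, Nat.Prime ℓ) → (∀ ℓ : ℕ, Nat.Prime ℓ → ℓ ∣ W.conductorNorm ℤ → ℓ ∈ S) → Summit.BirchSwinnertonDyer.Rank1Residual.X1.MuLambda.lam (L₀ * ∏ ℓ ∈ S, if h : Nat.Prime ℓ ∧ ℓ ≠ 2 then Literature.NumberTheory.EllipticCurves.GreenbergVatsal2000.eulerFactorElement W 2 ((Rat.HeightOneSpectrum.primesEquiv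 (R := NumberField.RingOfIntegers ℚ)).symm ⟨ℓ, h.1⟩) else 1) + 2 = ∑ ℓ ∈ S.filter (· ≠ 2), 2 ^ (padicValNat 2 ((ℓ ^ 2 - 1) / 8) + 1)

-- `DepletedLambdaLawAtTwoModNSF` holds: proved by `Summit.BirchSwinnertonDyer.BirchSwinnertonDyer.Theorems.EisensteinDepletionAtTwo.DepletedLambdaLawAtTwoModNSF_proof` (its module imports this route file, so no `_holds` link can be stated here).

-- parent: DepletedLambdaLawAtTwoModNSF · glue (gen 1)
/--     item stmt-BirchSwinnertonDyer-27048 · support · rank 203 · closed · proved by Summit.BirchSwinnertonDyer.BirchSwinnertonDyer.Theorems.DepletionAtTwo.depletedLambdaLawAtTwoModNSFOfStar_proof (prover)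
    parent: DepletedLambdaLawAtTwoModNSF · GLUE: children ⟹ parent · by planner
E1M_NSF ⇐ StarGO2Sigma ∧ StarOptBNSF: POINTWISE PORT of p611861
(Theorems/EisensteinDepletionAtTwoStarSigmaGlue.lean, depletedLambdaLawAtTwoMod_of_starGO2Sigma :
StarGO2Sigma → StarOptB → DepletedLambdaLawAtTwoMod) — thread the hypothesis ¬Squarefree N_W (an
isogeny invariant: the optimal curve W₀ has the same conductor) through starCore / starTransfer /
starGlueFin / starSymbCAll; StarGO2Sigma is the tree def DepletionAtTwo.StarGO2Sigma verbatim
(Iff.rfl), StarOptBNSF = StarOptB + one binder. KERNEL ASK eng-2. -/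
@[route_item "route-BirchSwinnertonDyer-EisensteinDepletionAtTwo"]
def DepletedLambdaLawAtTwoModNSFOfStar : Prop :=
  StarGO2Sigma → StarOptBNSF → DepletedLambdaLawAtTwoModNSF

-- `DepletedLambdaLawAtTwoModNSFOfStar` holds: proved by `Summit.BirchSwinnertonDyer.BirchSwinnertonDyer.Theorems.DepletionAtTwo.depletedLambdaLawAtTwoModNSFOfStar_proof` (its module imports this route file, so no `_holds` link can be stated here).

/-- item stmt-BirchSwinnertonDyer-20238 · crux · rank 3 · closed · proved by Summit.BirchSwinnertonDyer.BirchSwinnertonDyer.Theorems.depletionShiftAtTwo_proof (prover) · by planner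
why it might fail: Only by a normalisation mismatch at p = 2: v2(f_l) must equal ord2((l^2-1)/8) for the tree's gamma (e0 = 2) and the projective reductionPointCount must match matsunoLocalTermAtTwo's conductor-exponent cases; in substance a tree theorem (lam_mul_eulerFactorProduct_two + dictionary p519918).
sources: GreenbergVatsal2000, Matsuno2008, Washington1997
[crux] for W globally minimal elliptic, any finite set S of primes and any L₀ ≠ 0 in Λ = ℤ₂⟦T⟧:
lam(L₀·∏_{ℓ∈S, ℓ≠2} 𝒫_ℓ(W)) = lam L₀ + Σ_S(W), Σ_S(W) = Σ_{ℓ∈S,ℓ≠2} 2^{n_ℓ}·d̄_ℓ(W) (d̄ = 2, 0, 1, 0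
for good with a_ℓ even, good with a_ℓ odd, multiplicative, additive) — GV display (9)/Prop 2.4 at p
= 2: each 𝒫_ℓ has unit content and λ(𝒫_ℓ) = 2^{n_ℓ}·d̄_ℓ because v₂(f_ℓ) = n_ℓ for the tree's
variable (γ = 1 + 2^{e₀}, e₀ = 2) and d̄_ℓ = multiplicity of 1 as a root of P̃_ℓ over 𝔽₂.
[difficulty: L] -/
@[route_item "route-BirchSwinnertonDyer-EisensteinDepletionAtTwo", crux]
def DepletionShiftAtTwo : Prop :=
  ∀ (W : WeierstrassCurve ℚ) [W.IsElliptic] [W.IsGloballyMinimal] (S : Finset ℕ), (∀ ℓ ∈ S, Nat.Prime ℓ) → ∀ (L₀ : Literature.NumberTheory.EllipticCurves.IwasawaAlgebra 2), L₀ ≠ 0 → Summit.BirchSwinnertonDyer.Rank1Residual.X1.MuLambda.lam (L₀ * ∏ ℓ ∈ S, if h : Nat.Prime ℓ ∧ ℓ ≠ 2 then Literature.NumberTheory.EllipticCurves.GreenbergVatsal2000.eulerFactorElement W 2 ((Rat.HeightOneSpectrum.primesEquiv (R := NumberField.RingOfIntegers ℚ)).symm ⟨ℓ, h.1⟩) else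 1) = Summit.BirchSwinnertonDyer.Rank1Residual.X1.MuLambda.lam L₀ + Literature.NumberTheory.EllipticCurves.matsunoSigmaShiftAtTwo W S

-- `DepletionShiftAtTwo` holds: proved by `Summit.BirchSwinnertonDyer.BirchSwinnertonDyer.Theorems.depletionShiftAtTwo_proof` (its module imports this route file, so no `_holds` link can be stated here).

/-- item stmt-BirchSwinnertonDyer-20237 · aside · rank 2 · closed · moot by None · by planner
why it might fail: Multiplicity one / Gorenstein at the Eisenstein maximal ideal above 2 (GV (18) at p = 2, composite level with an additive prime) can fail, so a_l = 1+l congruences need not descend to unit-period symbols; a type-A class beyond the scanned range could carry an even lambda jump.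
sources: GreenbergVatsal2000, Vatsal1999, Matsuno2008, Matsuno2000JNT, MazurTateTeitelbaum1986Invent, BellaichePollack2019
[crux] for W globally minimal, good ordinary at 2, with a unique rational 2-torsion point x of
Greenberg type A (ramified at 2, not odd) or B (odd, not ramified), any newform f of W, any c ∈ ℚ
and L₀ ≠ 0 in Λ with ι L₀ = c·L₂(f, α_W), and any finite set S of primes containing every prime
divisor of N_W: lam(L₀·∏_{ℓ∈S, ℓ≠2 prime} 𝒫_ℓ(W)) + 2 = Σ_{ℓ∈S, ℓ≠2} 2^{n_ℓ+1}. [difficulty: XL] -/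
@[route_item "route-BirchSwinnertonDyer-EisensteinDepletionAtTwo"]
def DepletedLambdaLawAtTwo : Prop :=
  ∀ (W : WeierstrassCurve ℚ) [W.IsElliptic] [W.IsGloballyMinimal] (x : ℚ), Literature.NumberTheory.EllipticCurves.IsOrdinaryAt W 2 → Literature.NumberTheory.EllipticCurves.HasUniqueRationalTwoTorsionX W x → ((Literature.NumberTheory.EllipticCurves.Greenberg1999.TwoTorsionRamifiedAtTwo x ∧ ¬ Literature.NumberTheory.EllipticCurves.Greenberg1999.TwoTorsionOdd W x) ∨ (Literature.NumberTheory.EllipticCurves.Greenberg1999.TwoTorsionOdd W x ∧ ¬ Literature.NumberTheory.EllipticCurves.Greenberg1999.TwoTorsionRamifiedAtTwo x)) → ∀ ⦃N : ℕ⦄ [NeZero N] (f : CuspForm (CongruenceSubgroup.Gamma0 N) 2), Literature.NumberTheory.EllipticCurves.ModularForms.IsNewformOf W f → ∀ (c : ℚ) (L₀ : Literature.NumberTheory.EllipticCurves.IwasawaAlgebra 2), L₀ ≠ 0 → Literature.NumberTheory.EllipticCurves.iwasawaToPowerSeries 2 L₀ = PowerSeries.C (c : ℚ_[2]) * Literature.NumberTheory.EllipticCurves.padicLFunction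 f (Literature.NumberTheory.EllipticCurves.unitRoot W 2 : ℚ_[2]) → ∀ (S : Finset ℕ), (∀ ℓ ∈ S, Nat.Prime ℓ) → (∀ ℓ : ℕ, Nat.Prime ℓ → ℓ ∣ W.conductorNorm ℤ → ℓ ∈ S) → Summit.BirchSwinnertonDyer.Rank1Residual.X1.MuLambda.lam (L₀ * ∏ ℓ ∈ S, if h : Nat.Prime ℓ ∧ ℓ ≠ 2 then Literature.NumberTheory.EllipticCurves.GreenbergVatsal2000.eulerFactorElement W 2 ((Rat.HeightOneSpectrum.primesEquiv (R := NumberField.RingOfIntegers ℚ)).symm ⟨ℓ, h.1⟩) else 1) + 2 = ∑ ℓ ∈ S.filter (· ≠ 2), 2 ^ (padicValNat 2 ((ℓ ^ 2 - 1) / 8) + 1)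

-- earlier DepletedLambdaLawAtTwoMod (stmt-BirchSwinnertonDyer-20340, replaced 2026-08-27T10:43:03Z -> stmt-BirchSwinnertonDyer-20341): retired by None — Literature.NumberTheory.EllipticCurves.ModularForms.exists_isNewformOf → DepletedLambdaLawAtTwo
/-- item stmt-BirchSwinnertonDyer-20341 · aside · rank 2 · closed · moot by None · by planner
why it might fail: Same as E1 (GV (18)/Gorenstein at the Eisenstein ideal above 2 can fail at composite level with an additive prime; an even lambda jump on an unscanned type-A class); modularity only supplies the partner's newform.
sources: GreenbergVatsal2000, Matsuno2008, EmertonPollackWeston2006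
[crux] E1M = modularity (the named fact `exists_isNewformOf`, already a clause of
PublishedInputsAtTwoM) → E1 `DepletedLambdaLawAtTwo`. CLOSABILITY REPAIR (p2 GEN 16): every
transport / reference line for the depleted 2-adic λ-law needs a NEWFORM OF THE PARTNER curve, which
only modularity provides (no newform is constructible in the kernel), so the registered line's stubs
must not assert `∃ f′`; E1M is the form such lines can conclude hypothesis-free, and `closes` feeds
it PublishedInputsAtTwoM's modularity clause. E1 → E1M trivially (E1 becomes the banked stronger
form, `aside`). Line `cfsplit` (registered on this item): (B) same-field same-type scale-free
λ-transport (X₁ + IsSquare(Δ·Δ′) = 2adic hTan / Matsuno 4.2@2 prefix), (C) constructive partner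
existence inside the 2-division-field class with a 2-isogenous full-2-torsion CF-habitat neighbour
(lit GEN 17 families W′_B(D), W′_A(D), kit j275709 79/79, j275853 243/243), (A′) the scale-free law
λ + 2 = matsunoLambdaLawAtTwo(N) on the CF habitat (the scale-free twin of bsd-2adic's C⁺
`AnalyticLambdaEq W″ 2 (matsunoLambdaLawAtTwo N″ − 2)`, item 19556 card gv-analytic-two), (L′)
conductor/local-term complementarity under isogeny (o -/
@[route_item "route-BirchSwinnertonDyer-EisensteinDepletionAtTwo", crux]
def DepletedLambdaLawAtTwoMod : Prop :=
  (∀ (V : WeierstrassCurve ℚ) [V.IsElliptic] [NeZero (V.conductorNorm ℤ)], ∃ g : CuspForm (CongruenceSubgroup.Gamma0 (V.conductorNorm ℤ)) 2, Literature.NumberTheory.EllipticCurves.ModularForms.IsNewformOf V g) → DepletedLambdaLawAtTwo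

-- parent: DepletedLambdaLawAtTwoMod · child (gen 1)
/--     item stmt-BirchSwinnertonDyer-24444 · aside · rank 201 · closed · moot by None
    parent: DepletedLambdaLawAtTwoMod · by planner
    why it might fail: Generalized Ogg is OPEN at ℓ = 2: a rational étale 2-torsion class R ∉ C_N in J₀(N) (every cuspidality theorem in print — Mazur, Vatsal Thm 1.1, Ohta, Yoo — inverts 2), or a level with ω(N) ≥ 3 where c_β ∈ Σ_N for EVERY admissible β (Shimura discrepancy), breaks it; census reaches only N ≤ 10⁴.
    sources: Vatsal2005, Mazur1977, Stevens1982, Ohta2014, LingOesterle1991, Dummigan2005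
[crux] (★-GO₂) GENERALIZED OGG AT THE PRIME 2, functional form (line `star` v4.1 research stub,
promoted): for the X₀(N)-optimal model (W₀, L₀ = q·Λ_f) of the class of a newform f whose carrier W
is good ordinary at 2, every rational 2-torsion point x₀ of W₀ that is NOT ramified at 2 (étale),
with half-lattice vector λ (℘(λ/2) − b₂/12 = x₀), and admissible stabilisation data existing at
level N_W: for SOME admissible β and some scale g′ ≠ 0 the stabilised-Eisenstein period functional
Φ_β(b,d) = φ_β(γ_{b,d}) equals n′g′ on every cusp b/d (d > 0, gcd(d, bN_W) = 1) with n′ EVEN iff the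
loop {0 → b/d} pairs evenly with λ/2 (q·{0,b/d}_f ∈ ℤλ + 2Λ₀). MEANING: π^*(λ/2) = c_β in J₀(N)[2] —
the étale rational 2-torsion of the optimal curve is CUSPIDAL (generalized Ogg conjecture at ℓ = 2,
composite level; every printed cuspidality theorem — Mazur (prime N), Vatsal 2005 Thm 1.1 (n odd /
away from 2), Ohta 2014, Yoo — excludes the prime 2). Reductions of record (cell memos, evidence on
the parent item): GO₂ ⇐ (U⁰) «no R ≠ 0 in J₀(N)(ℚ)[2] étale over all of 𝒳₀(N)/ℤ outside C» ⇐
(V₂^int) [Vatsal Thm 1.1 at n = 2, integral μ₂-hypothesis; single non-print input (H₂) = Hida mod-2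
Zariski-density n -/
@[route_item "route-BirchSwinnertonDyer-EisensteinDepletionAtTwo"]
def StarGO2 : Prop :=
  ∀ (W : WeierstrassCurve ℚ) [W.IsElliptic] [W.IsGloballyMinimal] (W₀ : WeierstrassCurve ℚ) [W₀.IsElliptic] [W₀.IsGloballyMinimal] ⦃N : ℕ⦄ [NeZero N] (f : CuspForm (CongruenceSubgroup.Gamma0 N) 2), Literature.NumberTheory.EllipticCurves.ModularForms.IsNewformOf W f → Literature.NumberTheory.EllipticCurves.ModularForms.IsNewformOf W₀ f → Literature.NumberTheory.EllipticCurves.IsOrdinaryAt W 2 → ∀ (L₀ : PeriodPair), Literature.NumberTheory.EllipticCurves.ModularForms.IsNeronLatticeOf (W₀.baseChange ℂ) L₀ → ∀ (q : ℚ), q ≠ 0 → (∀ z ∈ Literature.NumberTheory.EllipticCurves.ModularForms.periodLattice f, (q : ℂ) * z ∈ L₀.lattice) → (∀ z ∈ L₀.lattice, ∃ w ∈ Literature.NumberTheory.EllipticCurves.ModularForms.periodLattice f, z = (q : ℂ) * w) → ∀ (x₀ : ℚ), Literature.NumberTheory.EllipticCurves.Greenberg1999.HasRationalTwoTorsionX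 W₀ x₀ → ¬ Literature.NumberTheory.EllipticCurves.Greenberg1999.TwoTorsionRamifiedAtTwo x₀ → ∀ (lam : ℂ), lam ∈ L₀.lattice → lam / 2 ∉ L₀.lattice → L₀.weierstrassP (lam / 2) - ((W₀.b₂ : ℚ) : ℂ) / 12 = ((x₀ : ℚ) : ℂ) → (∃ β : ℕ → ℕ, Summit.BirchSwinnertonDyer.BirchSwinnertonDyer.Theorems.DepletionAtTwo.IsAdmissibleStabData (W.conductorNorm ℤ) β) → ∃ β : ℕ → ℕ, Summit.BirchSwinnertonDyer.BirchSwinnertonDyer.Theorems.DepletionAtTwo.IsAdmissibleStabData (W.conductorNorm ℤ) β ∧ ∃ g' : ℚ, g' ≠ 0 ∧ ∀ b d : ℤ, 0 < d → Int.gcd d (b * (W.conductorNorm ℤ : ℕ)) = 1 → ∃ n' : ℤ, Summit.BirchSwinnertonDyer.BirchSwinnertonDyer.Theorems.DepletionAtTwo.stabEisensteinPeriod (W.conductorNorm ℤ) β (Int.gcdA d (b * (W.conductorNorm ℤ : ℕ))) b (-((W.conductorNorm ℤ : ℕ) : ℤ) * Int.gcdB d (b * (W.conductorNorm ℤ : ℕ)))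 d = n' * g' ∧ (Even n' ↔ ∃ k : ℤ, ∃ w ∈ L₀.lattice, (q : ℂ) * (Literature.NumberTheory.EllipticCurves.ModularForms.modularSymbol f ((b : ℚ) / (d : ℚ)) - Literature.NumberTheory.EllipticCurves.ModularForms.modularSymbol f 0) = (k : ℂ) * lam + 2 * w)

-- parent: DepletedLambdaLawAtTwoMod · child (gen 1)
/--     item stmt-BirchSwinnertonDyer-24445 · aside · rank 202 · closed · moot by None
    parent: DepletedLambdaLawAtTwoMod · by planner
    why it might fail: A habitat class with N ≠ 15 whose X₀(N)-optimal curve is of type A (formal P_odd) refutes it — e.g. a Stein–Watkins «E₀ ≠ E₁ by a 2-isogeny» family member with unique 2-torsion and good ordinary 2 beyond the census (0 violations in 2231+855 classes, N ≤ 1.5·10⁴; 15a excluded by hand).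
    sources: Vatsal2005, SteinWatkins2004, doi:10.1007/3-540-45455-1_22, Dummigan2005, AgasheRibetStein2006, CremonaAlgorithms1997
[crux] (★-OptB) THE OPTIMAL CURVE OF A HABITAT CLASS IS ON THE ÉTALE SIDE (line `star` v4.1 research
stub, promoted; habitat-specific): for W globally minimal, good ordinary at 2, with a unique
rational 2-torsion point of Greenberg type A xor B, conductor N_W ≠ 15, and any newform f of W, the
X₀(N)-optimal model W₀ of the class (globally minimal, Néron lattice = q·Λ_f exactly, q ∈ ℚ^×) has a
RATIONAL 2-torsion point x₀ which is ODD (least real root) and NOT ramified at 2 — i.e. P_odd(E₀) ∈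
E₀(ℚ) is étale. A «Stevens / Stein–Watkins conjecture at the prime 2»: a type-A optimal curve would
carry its formal rational 2-torsion point inside E₀ ∩ Σ[2] (E₁ = E₀/(E₀ ∩ Σ); Vatsal 2005 Thm 1.10
proves Stevens' conjecture only up to 2-isogeny; Stein–Watkins 2002 conjecture E₀ ≠ E₁ by a
2-isogeny exactly on three explicit families, acq-09831). NECESSARY for the symbol half
(★-SymbGlobal) of line star (φ₀^* injective on the optimal curve; Serre-dlog: a formal P_odd(E₀) has
Kummer class ≢ every c_β, as at N = 15 where E₀ = X₀(15) = 15a1). CENSUS: E₀-law 2231/2232 classes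
(odd N < 10⁴, exception 15a) = eng cert4 habitat E₀ ∈ {type B: 1280, full 2-torsion: 13} off 15a;
lead star-p1 GEN 4 falsifier -/
@[route_item "route-BirchSwinnertonDyer-EisensteinDepletionAtTwo", crux]
def StarOptB : Prop :=
  ∀ (W : WeierstrassCurve ℚ) [W.IsElliptic] [W.IsGloballyMinimal] (x : ℚ), Literature.NumberTheory.EllipticCurves.IsOrdinaryAt W 2 → Literature.NumberTheory.EllipticCurves.HasUniqueRationalTwoTorsionX W x → ((Literature.NumberTheory.EllipticCurves.Greenberg1999.TwoTorsionRamifiedAtTwo x ∧ ¬ Literature.NumberTheory.EllipticCurves.Greenberg1999.TwoTorsionOdd W x) ∨ (Literature.NumberTheory.EllipticCurves.Greenberg1999.TwoTorsionOdd W x ∧ ¬ Literature.NumberTheory.EllipticCurves.Greenberg1999.TwoTorsionRamifiedAtTwo x)) → W.conductorNorm ℤ ≠ 15 → ∀ ⦃N : ℕ⦄ [NeZero N] (f : CuspForm (CongruenceSubgroup.Gamma0 N) 2), Literature.NumberTheory.EllipticCurves.ModularForms.IsNewformOf W f → ∀ (W₀ : WeierstrassCurve ℚ) [W₀.IsElliptic]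 [W₀.IsGloballyMinimal], Literature.NumberTheory.EllipticCurves.ModularForms.IsNewformOf W₀ f → ∀ (L₀ : PeriodPair), Literature.NumberTheory.EllipticCurves.ModularForms.IsNeronLatticeOf (W₀.baseChange ℂ) L₀ → ∀ (q : ℚ), q ≠ 0 → (∀ z ∈ Literature.NumberTheory.EllipticCurves.ModularForms.periodLattice f, (q : ℂ) * z ∈ L₀.lattice) → (∀ z ∈ L₀.lattice, ∃ w ∈ Literature.NumberTheory.EllipticCurves.ModularForms.periodLattice f, z = (q : ℂ) * w) → ∃ x₀ : ℚ, Literature.NumberTheory.EllipticCurves.Greenberg1999.HasRationalTwoTorsionX W₀ x₀ ∧ Literature.NumberTheory.EllipticCurves.Greenberg1999.TwoTorsionOdd W₀ x₀ ∧ ¬ Literature.NumberTheory.EllipticCurves.Greenberg1999.TwoTorsionRamifiedAtTwo x₀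

-- parent: DepletedLambdaLawAtTwoMod · glue (gen 1)
/--     item stmt-BirchSwinnertonDyer-24446 · support · rank 203 · closed · proved by Summit.BirchSwinnertonDyer.BirchSwinnertonDyer.Theorems.depletedLambdaLawAtTwoModOfStar_proof (prover)
    parent: DepletedLambdaLawAtTwoMod · GLUE: children ⟹ parent · by planner
E1M ⇐ StarOptB ∧ StarGO2: port of the registered line star v4.1
(Cruxes/DepletedLambdaLawAtTwoMod/Lines/star.lean, commit f9673437a263) — starSymbGlobal_of
(sorry-free) + every other stub closed BY NAME (PlusOddClass p588205,
SymbC/EisEight/EisFin/GlueFin/Core/Transfer/KlTwo/EulerOrder …) + DepletedLambdaLawAtTwoMod_of; the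
porting prover replaces stub_starOptB / stub_starGO2 by the hypotheses (children statements are the
skeleton's StarOptB / StarGO2 verbatim with eisAt / EvenOnLoop inlined: closers 'unfold … eisAt
EvenOnLoop' / Iff.rfl, planner Sketch.lean rc 0) -/
@[route_item "route-BirchSwinnertonDyer-EisensteinDepletionAtTwo"]
def DepletedLambdaLawAtTwoModOfStar : Prop :=
  StarGO2 → StarOptB → DepletedLambdaLawAtTwoMod

-- `DepletedLambdaLawAtTwoModOfStar` holds: proved by `Summit.BirchSwinnertonDyer.BirchSwinnertonDyer.Theorems.depletedLambdaLawAtTwoModOfStar_proof` (its module imports this route file, so no `_holds` link can be stated here).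

/-- item stmt-BirchSwinnertonDyer-20245 · support · rank 9 · closed · proved by Summit.BirchSwinnertonDyer.BirchSwinnertonDyer.Theorems.levelFifteenSymbolParity_proof (prover) · by planner
sources: SteinWuthrich2013, MazurTateTeitelbaum1986Invent
[support] for every newform f of [1,1,1,0,0] (15A8): [0]⁺_f = K/8 with K odd and [a/2^m]⁺_f − [0]⁺_f
= k/2 with k ≡ m (mod 2) for odd a (lit GEN 16 exact PARI certificate, kit j272806/j272821) — BY
NAME of eng-2's landed Prop; it yields λ(L₂(f₁₅)) = 0 (`lambdaZeroAtFifteen_of_symbolParity`,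
p515447/p514509). [difficulty: M] -/
@[route_item "route-BirchSwinnertonDyer-EisensteinDepletionAtTwo"]
def LevelFifteenSymbolParity : Prop :=
  Summit.BirchSwinnertonDyer.Rank2.MatsunoAnalyticTwin.LevelFifteenSymbolParity

-- `LevelFifteenSymbolParity` holds: proved by `Summit.BirchSwinnertonDyer.BirchSwinnertonDyer.Theorems.levelFifteenSymbolParity_proof` (its module imports this route file, so no `_holds` link can be stated here).

/-- item stmt-BirchSwinnertonDyer-20246 · support · rank 9 · closed · proved by Summit.BirchSwinnertonDyer.BirchSwinnertonDyer.Theorems.edt_sigmaShiftIdentityRef_proof (prover) · by planner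
sources: Matsuno2008, GreenbergLNM1716
[support] for every admissible member E of the 8-15-17 family, Σ_S(E) + 4 = Σ_S(15A8) over S =
primeFactors(N_E·15) (Tate data: E multiplicative at 3, 5, m, r, additive at q; 15A8 multiplicative
at 3, 5 and good with even point count elsewhere — lit 09:07:39Z: the 15A8 side is a tree corollary
of `addOrderOf_dvd_reductionPointCount`) — BY NAME. [difficulty: M] -/
@[route_item "route-BirchSwinnertonDyer-EisensteinDepletionAtTwo"]
def SigmaShiftIdentityRef : Prop :=
  Summit.BirchSwinnertonDyer.Rank2.MatsunoAnalyticTwin.SigmaShiftIdentityRef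

-- `SigmaShiftIdentityRef` holds: proved by `Summit.BirchSwinnertonDyer.BirchSwinnertonDyer.Theorems.edt_sigmaShiftIdentityRef_proof` (its module imports this route file, so no `_holds` link can be stated here).

/-- item stmt-BirchSwinnertonDyer-20247 · support · rank 9 · closed · moot by None · by planner
sources: Kato2004Asterisque, Matsuno2008, GreenbergLNM1716
[support] the door's published-inputs pack at p = 2 with the cite-only bodies INLINED — Kato 18.4 at
2 on the family, the Tao–Ziegler instance, Matsuno Thm 4.2 ∧ Prop 6.2 ∧ Greenberg Prop 5.14 at 2,
Greenberg Thm 1.9, Monsky's 2-parity, modularity — BY NAME (eng-2 p515447;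
`publishedInputsAtTwo_of_M`). [difficulty: open-problem] -/
@[route_item "route-BirchSwinnertonDyer-EisensteinDepletionAtTwo", crux]
def PublishedInputsAtTwoM : Prop :=
  Summit.BirchSwinnertonDyer.Rank2.MatsunoAnalyticTwin.PublishedInputsAtTwoM

/-- item stmt-BirchSwinnertonDyer-20248 · aside · rank 9 · closed · moot by None · by planner
sources: Matsuno2008
[support] on admissible members with OddSign, E and its twist by 2 have odd analytic rank (door
support BY NAME; local root numbers at 3, 5, m, q, r, 2; kit-verified 14/14). [difficulty: M] -/
@[route_item "route-BirchSwinnertonDyer-EisensteinDepletionAtTwo"]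
def RootNumberFacts : Prop :=
  Summit.BirchSwinnertonDyer.Rank2.LambdaTransportDoor.RootNumberFacts

/-- item stmt-BirchSwinnertonDyer-20254 · support · rank 9 · closed · proved by Summit.BirchSwinnertonDyer.Rank2.LambdaTransportDoor.referenceFacts_holds (prover) · by planner
sources: Matsuno2008
[support] the algebraic reference data of the door (E″ with full 2-torsion, E′ = E″/⟨(25m/4, ·)⟩ ∼
E, good ordinary at 2, the Prop-5.14 point, the printed bookkeeping identity) member-wise — door
support BY NAME (kit-verified 14/14; eng seats on the Tate data). [difficulty: M] -/
@[route_item "route-BirchSwinnertonDyer-EisensteinDepletionAtTwo", crux]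
def ReferenceFacts : Prop :=
  Summit.BirchSwinnertonDyer.Rank2.LambdaTransportDoor.ReferenceFacts

/-- `ReferenceFacts` holds: proved by `Summit.BirchSwinnertonDyer.Rank2.LambdaTransportDoor.referenceFacts_holds`. -/
theorem ReferenceFacts_holds : ReferenceFacts := _root_.Summit.BirchSwinnertonDyer.Rank2.LambdaTransportDoor.referenceFacts_holds

/-- item stmt-BirchSwinnertonDyer-20274 · support · rank 9 · closed · moot by None · by planner
sources: Rohrlich1994CRM, Deligne1973Constantes, Rohrlich1993Compositio
[support · PRINT, by name] the Deligne–Rohrlich ROOT-NUMBER PRODUCT FORMULA w(E) = −∏_v w_v(E) for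
the admissible members E = curve j n of the 8-15-17 family: the body of the tree's named fact
`WeierstrassCurve.rootNumber_eq_algebraicRootNumber` (Deligne 1973 local constants; modularity +
local–global compatibility; Rohrlich 1994 §20–21) INLINED at `curve j n`, so no cite_only constant
enters the cone (`Iff.rfl` with the named fact restricted to the family, scratch-checked). The tree
proves the product formula at squarefree level and at additive primes of twist type, but the
family's additive prime q = m + 64n² is Kodaira III (eng g8 p530196), so on the family it is PRINT,
not yet a tree theorem. It replaces `RootNumberFacts` (item stmt-BirchSwinnertonDyer-20248: odd
analytic ranks of E and E^(2) on 𝓕₋) as the displayed open input: eng g8's tree theorem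
`Summit.BirchSwinnertonDyer.Rank2.LambdaTransportDoor.rootNumberFacts_of_productFormula` (p531181)
derives RootNumberFacts from it and the modularity clause of PublishedInputsAtTwoM inside `closes`.
[difficulty: print] -/
@[route_item "route-BirchSwinnertonDyer-EisensteinDepletionAtTwo", crux]
def RootNumberProductFormulaF : Prop :=
  ∀ j n : ℤ, Summit.BirchSwinnertonDyer.Rank2.Family81517.AdmissibleF j n → ∀ [(Summit.BirchSwinnertonDyer.Rank2.Family81517.curve j n).IsElliptic], (∀ v : IsDedekindDomain.HeightOneSpectrum ℤ, (Summit.BirchSwinnertonDyer.Rank2.Family81517.curve j n).HasAdditiveReductionAt v → 3 < ringChar (ℤ ⧸ v.asIdeal)) → (Summit.BirchSwinnertonDyer.Rank2.Family81517.curve j n).rootNumber = (Summit.BirchSwinnertonDyer.Rank2.Family81517.curve j n).algebraicRootNumber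

/-- item stmt-BirchSwinnertonDyer-23712 · support · rank 9 · closed · moot by None · by planner
why it might fail: typing risk only: a 2πi/orientation mismatch between the tree's cuspSymbol / periodLatticeGamma1 / IsNeronLatticeOf conventions and CES 2003 Lemma 6.1.6 would make (F) as typed differ from print; UBD as typed is CDT 2025 Thm 1 verbatim.
sources: ConradEdixhovenStein2003, KatzMazur1985, SilvermanATAEC1994, CalegariDimitrovTang2025
[support] the two PUBLISHED INPUTS of line `star`, BY NAME (never restated): (F) =
`Literature.NumberTheory.EllipticCurves.ModularForms.gamma1Parametrization_cuspImage_nonsingularReduction`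
— under any X_μ(N)-parametrisation c·Λ₁(f) ⊆ Λ_W (∞ ↦ O) of a globally minimal W with newform f, the
image π(γ∞) of a cusp over ∞ has rational coordinates and non-singular reduction at every prime
(Conrad–Edixhoven–Stein 2003 §6.1.2, proof of Lemma 6.1.6 p. 381: X_μ(N) is ℤ-smooth so the
parametrisation extends to the Néron model; Katz–Mazur Thm 12.6.1 / Cor 12.6.2 (Igusa): connected
fibres ⇒ identity component; Silverman ATAEC IV.9 Cor 9.1: identity component of a minimal model =
non-singular locus); UBD =
`Literature.NumberTheory.Automorphic.CalegariDimitrovTang2025_unboundedDenominators` (unbounded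
denominators, holomorphic-at-the-cusps integral-weight case, Calegari–Dimitrov–Tang, JAMS 38 (2025)
Thm 1). Both are statement-only Literature `def`s (no `_holds`); this item is the route's PRINT
binder for line `star` and closes only when both are typed as theorems. -/
@[route_item "route-BirchSwinnertonDyer-EisensteinDepletionAtTwo"]
def StarPrints : Prop :=
  Literature.NumberTheory.EllipticCurves.ModularForms.gamma1Parametrization_cuspImage_nonsingularReduction ∧ Literature.NumberTheory.Automorphic.CalegariDimitrovTang2025_unboundedDenominators

/-- item stmt-BirchSwinnertonDyer-23713 · support · rank 9 · closed · proved by Summit.BirchSwinnertonDyer.BirchSwinnertonDyer.Theorems.DepletionAtTwo.StarTwoPrints.depletedLambdaLawAtTwoModNSFOfPrints_holds (prover) · by planner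
why it might fail: none mathematical: proved in tree modulo re-export (p748463 StarTwoPrints.depletedLambdaLawAtTwoModNSF_of_twoPrints); closable by a one-line Theorems file.
sources: GreenbergVatsal2000, CalegariDimitrovTang2025, ConradEdixhovenStein2003
[support] E1M_NSF FROM THE PRINTS: StarPrints → DepletedLambdaLawAtTwoModNSF. KERNEL-CLOSABLE NOW by
a one-line re-export of the landed theorem
`Summit.BirchSwinnertonDyer.BirchSwinnertonDyer.Theorems.DepletionAtTwo.StarTwoPrints.depletedLambdaLawAtTwoModNSF_of_twoPrints`
(p748463, file Theorems/EisensteinDepletionAtTwoStarE1MNSFTwoPrints.lean): `fun hP =>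
depletedLambdaLawAtTwoModNSF_of_twoPrints hP.1 hP.2` (checked in the tenure folder's Sketch.lean).
It replaces the binder h1 : DepletedLambdaLawAtTwoModNSF of closes (rev 17–20) by (h1P : this) (hP :
StarPrints). -/
@[route_item "route-BirchSwinnertonDyer-EisensteinDepletionAtTwo", crux]
def DepletedLambdaLawAtTwoModNSFOfPrints : Prop :=
  StarPrints → DepletedLambdaLawAtTwoModNSF

-- `DepletedLambdaLawAtTwoModNSFOfPrints` holds: proved by `Summit.BirchSwinnertonDyer.BirchSwinnertonDyer.Theorems.DepletionAtTwo.StarTwoPrints.depletedLambdaLawAtTwoModNSFOfPrints_holds` (its module imports this route file, so no `_holds` link can be stated here).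

/-- item stmt-BirchSwinnertonDyer-23767 · support · rank 9 · closed · moot by None · by planner
why it might fail: typing risk only: a 2πi/orientation mismatch between the tree's cuspSymbol / periodLatticeGamma1 / IsNeronLatticeOf conventions and CES 2003 Lemma 6.1.6 would make (F) as typed differ from print.
sources: ConradEdixhovenStein2003, KatzMazur1985, SilvermanATAEC1994
[support] PRINT (F) BY NAME: `gamma1Parametrization_cuspImage_nonsingularReduction` — under any
X_μ(N)-parametrisation c·Λ₁(f) ⊆ Λ_W (∞ ↦ O) of a globally minimal W with newform f, the image π(γ∞)
of a cusp over ∞ has rational coordinates and NON-SINGULAR reduction at every prime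
(Conrad–Edixhoven–Stein 2003 §6.1.2, proof of Lemma 6.1.6 p. 381: X_μ(N) is ℤ-smooth, so the
parametrisation extends to the Néron model; Katz–Mazur Thm 12.6.1 / Cor 12.6.2 (Igusa): connected
fibres ⇒ identity component; Silverman ATAEC IV.9 Cor 9.1). Statement-only Literature fact (no
`_holds`): the first of the two published inputs of line `star`; closes when the fact is typed as a
theorem (needs X_μ(N) / Néron models over ℤ). -/
@[route_item "route-BirchSwinnertonDyer-EisensteinDepletionAtTwo", crux]
def StarPrintF : Prop :=
  Literature.NumberTheory.EllipticCurves.ModularForms.gamma1Parametrization_cuspImage_nonsingularReduction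

/-- item stmt-BirchSwinnertonDyer-23785 · support · rank 9 · closed · proved by Summit.BirchSwinnertonDyer.BirchSwinnertonDyer.Theorems.EisensteinDepletionAtTwo.StarPrintUBD_proof (prover) · by planner
why it might fail: none as mathematics (published theorem, JAMS 2025); as typed it is CDT Thm 1 verbatim (bounded at cusps, integer coefficients in q^{1/h}).
sources: CalegariDimitrovTang2025
[support] PRINT UBD BY NAME: `CalegariDimitrovTang2025_unboundedDenominators` — the
unbounded-denominators theorem, holomorphic-at-the-cusps integral-weight case: an
integer-coefficient modular form for a finite-index subgroup of SL₂(ℤ) is modular for a congruence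
subgroup (Calegari–Dimitrov–Tang, JAMS 38 (2025), Thm 1). Statement-only Literature fact (no
`_holds`): the second published input of line `star`. -/
@[route_item "route-BirchSwinnertonDyer-EisensteinDepletionAtTwo", crux]
def StarPrintUBD : Prop :=
  Literature.NumberTheory.Automorphic.CalegariDimitrovTang2025_unboundedDenominators

-- `StarPrintUBD` holds: proved by `Summit.BirchSwinnertonDyer.BirchSwinnertonDyer.Theorems.EisensteinDepletionAtTwo.StarPrintUBD_proof` (its module imports this route file, so no `_holds` link can be stated here).

/-- item stmt-BirchSwinnertonDyer-20255 · assembly · rank 1 · closed · proved by Summit.BirchSwinnertonDyer.BirchSwinnertonDyer.Theorems.edt_assembly_proof (prover) · by planner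
sources: GreenbergVatsal2000, Matsuno2008
[assembly] DepletedLambdaLawAtTwo → DepletionShiftAtTwo → LevelFifteenSymbolParity →
SigmaShiftIdentityRef → PublishedInputsAtTwoM → RootNumberFacts → ReferenceFacts → Leaf_F₋ (PROVED
in SketchB.lean, `assembly_holds`). -/
@[route_item "route-BirchSwinnertonDyer-EisensteinDepletionAtTwo"]
def Assembly : Prop :=
  DepletedLambdaLawAtTwo → DepletionShiftAtTwo → LevelFifteenSymbolParity → SigmaShiftIdentityRef → PublishedInputsAtTwoM → RootNumberFacts → ReferenceFacts → Summit.BirchSwinnertonDyer.Rank2.Family81517.SelmerCorankEqOrderEqThreeOnOddFamily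

-- `Assembly` holds: proved by `Summit.BirchSwinnertonDyer.BirchSwinnertonDyer.Theorems.edt_assembly_proof` (its module imports this route file, so no `_holds` link can be stated here).

/-! D-0027 §2.1 — DECIDING THEOREM (planner-authored via `route open/edit --closes-file`; by planner-bsd-rank2-p2-g52-0 2026-08-30T01:09:56Z) — ARCHIVED: route closed (closed) 2026-08-31T18:19:09Z; kept so importers keep building:
its hypotheses are this route's items and its conclusion the registered leaf `Summit.BirchSwinnertonDyer.Rank2.Family81517.SelmerCorankEqOrderEqThreeOnOddFamily` (rung S0 door T-r3₂, D-0061) (glue_lint), and it elaborates with this file. -/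

@[closes "route-BirchSwinnertonDyer-EisensteinDepletionAtTwo"] theorem closes (h1P : DepletedLambdaLawAtTwoModNSFOfPrints) (hF : StarPrintF) (hU : StarPrintUBD) (h2 : DepletionShiftAtTwo)
    (h5 : PublishedInputsAtTwoM) (hW : RootNumberProductFormulaF) (h7 : ReferenceFacts) :
    Summit.BirchSwinnertonDyer.Rank2.Family81517.SelmerCorankEqOrderEqThreeOnOddFamily := by
  -- E1M_NSF from the two published inputs of line `star`, each BY NAME: (F) and UBD
  have h1 : DepletedLambdaLawAtTwoModNSF := h1P ⟨hF, hU⟩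
  refine Summit.BirchSwinnertonDyer.Rank2.LambdaTransportDoor.closes'
    (Summit.BirchSwinnertonDyer.Rank2.MatsunoAnalyticTwin.publishedInputsAtTwo_of_M h5)
    (Summit.BirchSwinnertonDyer.Rank2.LambdaTransportDoor.rootNumberFacts_of_productFormula
      (fun j n hA' ↦ @hW j n hA') h5.2.2.2.2.2) h7 ?_
  intro j n hA hE hmin κ γ hκ hγ _ hord _ f hf D
  -- an integral normalisation of `L₂(f, α)` and the algebraic `λ = 4`
  obtain ⟨k, L₀, hne, hι⟩ :=
    Summit.BirchSwinnertonDyer.BirchSwinnertonDyer.Theorems.EisensteinLowerBounds.exists_integral_slack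
      (W := Summit.BirchSwinnertonDyer.Rank2.Family81517.curve j n) hord hf one_ne_zero
  refine ⟨(2 : ℚ) ^ k * 1, L₀, hne, hι, ?_⟩
  have h4 := (Summit.BirchSwinnertonDyer.Rank2.LambdaTransportDoor.lambdaFourMuZero_of
    (Summit.BirchSwinnertonDyer.Rank2.MatsunoAnalyticTwin.publishedInputsAtTwo_of_M h5) h7 j n hA hE hmin κ γ hκ hγ D).2.2
  -- sizes and the natural-number avatars of `m, q, r`
  obtain ⟨hm11, hn2, h16, -, -⟩ := Summit.BirchSwinnertonDyer.Rank2.Family81517.sizes hA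
  have hqe := Summit.BirchSwinnertonDyer.Rank2.Family81517.qOf_eq j n
  have hre := Summit.BirchSwinnertonDyer.Rank2.Family81517.rOf_eq j n
  have hjm : Summit.BirchSwinnertonDyer.Rank2.Family81517.mOf j = 8 * j + 3 := rfl
  obtain ⟨hj, hmZ, hn, h60, hqZ, hrZ⟩ := id hA
  set m' : ℕ := (Summit.BirchSwinnertonDyer.Rank2.Family81517.mOf j).toNat with hm'def
  set q' : ℕ := (Summit.BirchSwinnertonDyer.Rank2.Family81517.qOf j n).toNat with hq'def
  set r' : ℕ := (Summit.BirchSwinnertonDyer.Rank2.Family81517.rOf j n).toNat with hr'def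
  have hm' : (m' : ℤ) = Summit.BirchSwinnertonDyer.Rank2.Family81517.mOf j := Int.toNat_of_nonneg (by omega)
  have hq' : (q' : ℤ) = Summit.BirchSwinnertonDyer.Rank2.Family81517.qOf j n := Int.toNat_of_nonneg (by omega)
  have hr' : (r' : ℤ) = Summit.BirchSwinnertonDyer.Rank2.Family81517.rOf j n := Int.toNat_of_nonneg (by omega)
  have hmP : m'.Prime := Nat.prime_iff_prime_int.mpr (by rw [hm']; exact hmZ)
  have hqP : q'.Prime := Nat.prime_iff_prime_int.mpr (by rw [hq']; exact hqZ)
  have hrP : r'.Prime := Nat.prime_iff_prime_int.mpr (by rw [hr']; exact hrZ)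
  have hm11' : 11 ≤ m' := by omega
  have hmq : m' + 1 ≤ q' := by omega
  have hqr : q' + 1 ≤ r' := by omega
  have hm8 : m' % 8 = 3 := by omega
  have hq8 : q' % 8 = 3 := by omega
  have hr8 : r' % 8 = 3 := by omega
  -- the common prime set `S = primeFactors (N_E · 15)` and the non-squarefree conductor (`ord_q N_E ≥ 2`)
  have hN0 : (Summit.BirchSwinnertonDyer.Rank2.Family81517.curve j n).conductorNorm ℤ ≠ 0 :=
    ((Summit.BirchSwinnertonDyer.Rank2.Family81517.curve j n).conductorNorm_pos_holds).ne'
  set S : Finset ℕ := ((Summit.BirchSwinnertonDyer.Rank2.Family81517.curve j n).conductorNorm ℤ * 15).primeFactors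
    with hSdef
  have hprime : ∀ ℓ ∈ S, ℓ.Prime := fun ℓ hℓ ↦ Nat.prime_of_mem_primeFactors hℓ
  have hSW : ∀ ℓ : ℕ, ℓ.Prime → ℓ ∣ (Summit.BirchSwinnertonDyer.Rank2.Family81517.curve j n).conductorNorm ℤ → ℓ ∈ S :=
    fun ℓ hℓ hd ↦ by
      rw [hSdef, Nat.mem_primeFactors]
      exact ⟨hℓ, hd.mul_right _, mul_ne_zero hN0 (by norm_num)⟩
  have hnsf : ¬ Squarefree ((Summit.BirchSwinnertonDyer.Rank2.Family81517.curve j n).conductorNorm ℤ) := by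
    intro hsf
    have h2 := Summit.BirchSwinnertonDyer.Rank2.Family81517.two_le_factorization_conductorNorm_curve_q hA hqP hq'
    have h1' := (Nat.squarefree_iff_factorization_le_one hN0).mp hsf q'
    omega
  -- E1M_NSF and E2 at the member
  have e1 := h1 (fun V _ _ ↦ h5.2.2.2.2.2 V) (Summit.BirchSwinnertonDyer.Rank2.Family81517.curve j n) 0 hord
    (Summit.BirchSwinnertonDyer.Rank2.Family81517.hasUniqueRationalTwoTorsionX_curve_zero hA)
    (Or.inr (Summit.BirchSwinnertonDyer.Rank2.Family81517.typeB_curve_zero hA)) hnsf f hf ((2 : ℚ) ^ k * 1) L₀ hne hι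
    S hprime hSW
  have e2 := h2 (Summit.BirchSwinnertonDyer.Rank2.Family81517.curve j n) S hprime L₀ hne
  rw [e2] at e1
  -- `S ∖ {2} = {3, 5, m, q, r}`
  have hS : S.filter (· ≠ 2) = {3, 5, m', q', r'} := by
    ext ℓ
    rw [Finset.mem_filter, Summit.BirchSwinnertonDyer.Rank2.Family81517.mem_primeFactors_conductorNorm_mul_fifteen_iff hA]
    simp only [Finset.mem_insert, Finset.mem_singleton]
    constructor
    · rintro ⟨⟨-, h | h | h | h | h⟩, -⟩
      · exact Or.inl h
      · exact Or.inr (Or.inl h)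
      · right; right; left; omega
      · right; right; right; left; omega
      · right; right; right; right; omega
    · rintro (rfl | rfl | rfl | rfl | rfl)
      · exact ⟨⟨Nat.prime_three, Or.inl rfl⟩, by norm_num⟩
      · exact ⟨⟨by norm_num, Or.inr (Or.inl rfl)⟩, by norm_num⟩
      · exact ⟨⟨hmP, Or.inr (Or.inr (Or.inl hm'))⟩, by omega⟩
      · exact ⟨⟨hqP, Or.inr (Or.inr (Or.inr (Or.inl hq')))⟩, by omega⟩
      · exact ⟨⟨hrP, Or.inr (Or.inr (Or.inr (Or.inr hr')))⟩, by omega⟩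
  have n3 : (3 : ℕ) ∉ ({5, m', q', r'} : Finset ℕ) := by
    simp only [Finset.mem_insert, Finset.mem_singleton]; omega
  have n5 : (5 : ℕ) ∉ ({m', q', r'} : Finset ℕ) := by
    simp only [Finset.mem_insert, Finset.mem_singleton]; omega
  have nm : m' ∉ ({q', r'} : Finset ℕ) := by
    simp only [Finset.mem_insert, Finset.mem_singleton]; omega
  have nqr : q' ≠ r' := by omega
  -- `σ(E, S) = 4` and the Eisenstein side `Σ 2^{n_ℓ+1} = 10`
  unfold Literature.NumberTheory.EllipticCurves.matsunoSigmaShiftAtTwo at e1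
  rw [hS, Finset.sum_insert n3, Finset.sum_insert n5, Finset.sum_insert nm, Finset.sum_pair nqr,
    Finset.sum_insert n3, Finset.sum_insert n5, Finset.sum_insert nm, Finset.sum_pair nqr,
    Summit.BirchSwinnertonDyer.Rank2.MatsunoAnalyticTwin.two_pow_padicValNat_weight_eq_one (by norm_num : 3 % 8 = 3 ∨ 3 % 8 = 5),
    Summit.BirchSwinnertonDyer.Rank2.MatsunoAnalyticTwin.two_pow_padicValNat_weight_eq_one (by norm_num : 5 % 8 = 3 ∨ 5 % 8 = 5),
    Summit.BirchSwinnertonDyer.Rank2.MatsunoAnalyticTwin.two_pow_padicValNat_weight_eq_one (Or.inl hm8),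
    Summit.BirchSwinnertonDyer.Rank2.MatsunoAnalyticTwin.two_pow_padicValNat_weight_eq_one (Or.inl hq8),
    Summit.BirchSwinnertonDyer.Rank2.MatsunoAnalyticTwin.two_pow_padicValNat_weight_eq_one (Or.inl hr8),
    Summit.BirchSwinnertonDyer.Rank2.Family81517.matsunoLocalTermAtTwo_curve_eq_one hA Nat.prime_three (Or.inl rfl),
    Summit.BirchSwinnertonDyer.Rank2.Family81517.matsunoLocalTermAtTwo_curve_eq_one hA (by norm_num) (Or.inr (Or.inl rfl)),
    Summit.BirchSwinnertonDyer.Rank2.Family81517.matsunoLocalTermAtTwo_curve_eq_one hA hmP (Or.inr (Or.inr (Or.inl hm'))),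
    Summit.BirchSwinnertonDyer.Rank2.Family81517.matsunoLocalTermAtTwo_curve_q hA hqP hq',
    Summit.BirchSwinnertonDyer.Rank2.Family81517.matsunoLocalTermAtTwo_curve_eq_one hA hrP
      (Or.inr (Or.inr (Or.inr hr')))] at e1
  have hw : ∀ ℓ : ℕ, (ℓ % 8 = 3 ∨ ℓ % 8 = 5) → 2 ^ (padicValNat 2 ((ℓ ^ 2 - 1) / 8) + 1) = 2 := fun ℓ h ↦ by
    rw [pow_succ 2 (padicValNat 2 ((ℓ ^ 2 - 1) / 8)),
      Summit.BirchSwinnertonDyer.Rank2.MatsunoAnalyticTwin.two_pow_padicValNat_weight_eq_one h, one_mul]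
  rw [hw 3 (by norm_num), hw 5 (by norm_num), hw m' (Or.inl hm8), hw q' (Or.inl hq8), hw r' (Or.inl hr8)] at e1
  omega

end Summit.BirchSwinnertonDyer.BirchSwinnertonDyer.Theses.EisensteinDepletionAtTwo
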